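import Mathlib
import Summits.Ventures.PercRepro2.LocRows
import Summits.Ventures.PercRepro2.SwRow
import Summits.Ventures.PercRepro2.SwOut
import Summits.Ventures.PercRepro2.SwAllRow
import Summits.Ventures.PercRepro2.SwOutAll
import Summits.Ventures.PercRepro2.SwOutArmFlip
import Summits.Ventures.PercRepro2.SwOutArmThm
import Summits.Ventures.PercRepro2.SwOutCoreDefs
import Summits.Ventures.PercRepro2.SwOutBigBlockDefs
import Summits.Ventures.PercRepro2.SwOutMixedBaseDefs
import Summits.Ventures.PercRepro2.SwOutMixedBaseClasses
import Summits.Ventures.PercRepro2.SwOutMixedBaseHull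
import Summits.Ventures.PercRepro2.SwOutMixedBaseDual

/-!
# The mixed base: the property G5 is the arm principle for the coarse arm of `u` (blind cell
PercRepro2, night-4 g17, 2026-08-27; proofs/NIGHT4-G17.md §4‴ (corrected))

At a point with every u-arm red and `p` dropped (the u–p edges blue), the coarse arm of `u` in the
hull is `X = {u} ∪ ⋃ U j` (`coarseX`): it is a union of arms of the hull (`armClosed_coarseX`), lies
in the red cluster, and the point is core-free (`coreFree_of_top`).  Flipping `X` is the move to the
point with every u-arm blue and the u–p edges red (`flip_coarseX`), so the landed arm principle
`flip_mem_tgtU_of_armClosed_red` gives **G5**: the conditioning `Q` is preserved by that move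
(`mem_tgtU_toggleX`) — the property of the conditioning set that the corrected abstract lemma of
the big block needs beyond lowerness.
-/

namespace Summit.Ventures.PercRepro2

namespace BigBlock

open Hull LocRows

variable {V : Type*} {E : Type*}

open scoped Classical

section ArmDefs

variable (u : V) {ι κ : Type*} (U : ι → Set V)

/-- The coarse arm of `u`: `u` with the u-arms. -/
def coarseX : Set V := {u} ∪ ⋃ j, U j

/-- The X-move of a point: every u-arm toggled, the u–p edges toggled. -/
def toggleX (q : Pt ι κ) : Pt ι κ := (flipAll q.1, q.2.1, !q.2.2.1, q.2.2.2.1, q.2.2.2.2)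

end ArmDefs

section Arm

variable {ends : E → Sym2 V} {σ : Config E} {h u p : V} {ι κ : Type*} {U : ι → Set V} {Ah : Set V}
  {F : κ → Set V} (hb : MixedBase ends σ h u p U Ah F)
include hb

/-- An edge touches `coarseX` iff it touches a u-arm or is a u–p edge. -/
lemma MixedBase.touches_coarseX_iff {e : E} :
    e ∈ touches ends (coarseX u U) ↔ (∃ j, e ∈ touches ends (U j)) ∨ e ∈ clsUP ends u p := by
  constructor
  · rintro ⟨x, hx, y, hxy⟩
    rcases hx with hx | hx
    · rw [Set.mem_singleton_iff] at hx
      subst hx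
      rcases hb.u_edges e y hxy with ⟨j, hj⟩ | rfl
      · exact Or.inl ⟨j, y, hj, x, ends_swap hxy⟩
      · exact Or.inr hxy
    · obtain ⟨j, hj⟩ := Set.mem_iUnion.1 hx
      exact Or.inl ⟨j, x, hj, y, hxy⟩
  · rintro (⟨j, x, hx, y, hxy⟩ | hup)
    · exact ⟨x, Or.inr (Set.mem_iUnion.2 ⟨j, hx⟩), y, hxy⟩
    · exact ⟨u, Or.inl rfl, p, hup⟩

/-- **Flipping the coarse arm of `u` is the X-move.** -/
theorem MixedBase.flip_coarseX (q : Pt ι κ) :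
    flip ends (coarseX u U) (mixedReal ends u p U Ah F σ q) =
      mixedReal ends u p U Ah F σ (toggleX q) := by
  funext e
  by_cases hX : e ∈ touches ends (coarseX u U)
  · rw [flip_apply_of_mem hX]
    rcases hb.touches_coarseX_iff.1 hX with ⟨j, hj⟩ | hup
    · rw [hb.mixedReal_apply_U hj, hb.mixedReal_apply_U hj]
      simp only [toggleX, flipAll]
      by_cases hj' : q.1 j = true <;> simp [hj']
    · rw [hb.mixedReal_apply_UP hup, hb.mixedReal_apply_UP hup]
      simp only [toggleX]
      by_cases hc' : q.2.2.1 = true <;> simp [hc']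
  · rw [flip_apply_of_notMem hX]
    have hU : ∀ j, e ∉ touches ends (U j) := fun j hj => hX (hb.touches_coarseX_iff.2 (Or.inl ⟨j, hj⟩))
    have hUP : e ∉ clsUP ends u p := fun hup => hX (hb.touches_coarseX_iff.2 (Or.inr hup))
    by_cases hA : e ∈ touches ends Ah
    · rw [hb.mixedReal_apply_Ah hA, hb.mixedReal_apply_Ah hA]; rfl
    by_cases hXt : e ∈ clsExt ends u p Ah
    · rw [hb.mixedReal_apply_Ext hXt, hb.mixedReal_apply_Ext hXt]; rfl
    by_cases hF : ∃ k, e ∈ touches ends (F k)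
    · obtain ⟨k, hk⟩ := hF
      rw [hb.mixedReal_apply_F hk, hb.mixedReal_apply_F hk]; rfl
    · simp only [not_exists] at hF
      rw [MixedBase.mixedReal_apply_none hU hA hUP hXt hF,
        MixedBase.mixedReal_apply_none hU hA hUP hXt hF]

omit hb in
/-- At a point with every u-arm red and `p` dropped there is no red-side leak. -/
lemma not_leakR_of_top {q : Pt ι κ} (huP : q.2.2.1 = false) : ¬ LeakR q := by
  rintro ⟨_, h2, _⟩
  rw [huP] at h2
  exact absurd h2 (by decide)

omit hb in
/-- At a point with every u-arm red there is no blue-side leak. -/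
lemma not_leakB_of_top {q : Pt ι κ} (hs : ∀ j, q.1 j = true) : ¬ LeakB q := by
  rintro ⟨⟨j, hj⟩, _, _⟩
  simp only [flipPt, flipAll] at hj
  rw [hs j] at hj
  exact absurd hj (by decide)

/-- The red cluster at a point with every u-arm red and `p` dropped. -/
lemma MixedBase.cluster_top [Nonempty ι] (hup : ∃ e, ends e = s(u, p)) {q : Pt ι κ}
    (hs : ∀ j, q.1 j = true) (huP : q.2.2.1 = false) {x : V} :
    x ∈ cluster ends (mixedReal ends u p U Ah F σ q) h ↔
      x = h ∨ (∃ j, x ∈ U j) ∨ x = u ∨ (q.2.1 = true ∧ x ∈ Ah) ∨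
        ∃ k, q.2.2.2.2 k = true ∧ x ∈ F k := by
  rw [hb.cluster_mixedReal hup (not_leakR_of_top huP), mem_redSetM_iff]
  obtain ⟨j₀⟩ := (inferInstance : Nonempty ι)
  constructor
  · rintro (hxh | ⟨j, _, hx⟩ | ⟨hxu, _⟩ | ⟨_, _, hP⟩ | ⟨ha, hx⟩ | ⟨k, hk, hx⟩)
    · exact Or.inl hxh
    · exact Or.inr (Or.inl ⟨j, hx⟩)
    · exact Or.inr (Or.inr (Or.inl hxu))
    · rw [huP] at hP; exact absurd hP (by decide)
    · exact Or.inr (Or.inr (Or.inr (Or.inl ⟨ha, hx⟩)))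
    · exact Or.inr (Or.inr (Or.inr (Or.inr ⟨k, hk, hx⟩)))
  · rintro (hxh | ⟨j, hx⟩ | hxu | ⟨ha, hx⟩ | ⟨k, hk, hx⟩)
    · exact Or.inl hxh
    · exact Or.inr (Or.inl ⟨j, hs j, hx⟩)
    · exact Or.inr (Or.inr (Or.inl ⟨hxu, j₀, hs j₀⟩))
    · exact Or.inr (Or.inr (Or.inr (Or.inr (Or.inl ⟨ha, hx⟩))))
    · exact Or.inr (Or.inr (Or.inr (Or.inr (Or.inr ⟨k, hk, hx⟩))))

/-- The blue cluster at a point with every u-arm red. -/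
lemma MixedBase.cluster_blue_top (hup : ∃ e, ends e = s(u, p)) {q : Pt ι κ}
    (hs : ∀ j, q.1 j = true) {x : V} :
    x ∈ cluster ends (blue (mixedReal ends u p U Ah F σ q)) h ↔
      x = h ∨ (q.2.1 = false ∧ x ∈ Ah) ∨ ∃ k, q.2.2.2.2 k = false ∧ x ∈ F k := by
  rw [hb.cluster_blue_mixedReal hup (not_leakB_of_top hs), mem_redSetM_iff]
  have hs' : ∀ j, (flipPt q).1 j = false := by
    intro j; simp only [flipPt, flipAll]; rw [hs j]; rfl
  constructor
  · rintro (hxh | ⟨j, hj, _⟩ | ⟨_, j, hj⟩ | ⟨_, ⟨j, hj⟩, _⟩ | ⟨ha, hx⟩ | ⟨k, hk, hx⟩)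
    · exact Or.inl hxh
    · rw [hs' j] at hj; exact absurd hj (by decide)
    · rw [hs' j] at hj; exact absurd hj (by decide)
    · rw [hs' j] at hj; exact absurd hj (by decide)
    · refine Or.inr (Or.inl ⟨?_, hx⟩)
      simp only [flipPt] at ha
      cases h' : q.2.1
      · rfl
      · rw [h'] at ha; exact absurd ha (by decide)
    · refine Or.inr (Or.inr ⟨k, ?_, hx⟩)
      simp only [flipPt, flipAll] at hk
      cases h' : q.2.2.2.2 k
      · rfl
      · rw [h'] at hk; exact absurd hk (by decide)
  · rintro (hxh | ⟨ha, hx⟩ | ⟨k, hk, hx⟩)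
    · exact Or.inl hxh
    · refine Or.inr (Or.inr (Or.inr (Or.inr (Or.inl ⟨?_, hx⟩))))
      simp only [flipPt]; rw [ha]; rfl
    · refine Or.inr (Or.inr (Or.inr (Or.inr (Or.inr ⟨k, ?_, hx⟩))))
      simp only [flipPt, flipAll]; rw [hk]; rfl

/-- **A point with every u-arm red and `p` dropped is core-free.** -/
theorem MixedBase.coreFree_top [Nonempty ι] (hup : ∃ e, ends e = s(u, p)) {q : Pt ι κ}
    (hs : ∀ j, q.1 j = true) (huP : q.2.2.1 = false) :
    CoreFree ends (mixedReal ends u p U Ah F σ q) h := by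
  intro x hxT hxB
  rw [hb.cluster_top hup hs huP] at hxT
  rw [hb.cluster_blue_top hup hs] at hxB
  rcases hxB with hxh | ⟨ha', hxA⟩ | ⟨k, hk', hxF⟩
  · exact hxh
  · rcases hxT with hxh | ⟨j, hxU⟩ | hxu | ⟨ha, _⟩ | ⟨k, _, hxF⟩
    · exact hxh
    · exact absurd hxA (hb.U_disj_Ah j x hxU)
    · rw [hxu] at hxA; exact absurd hxA hb.u_notMem_Ah
    · rw [ha] at ha'; exact absurd ha' (by decide)
    · exact absurd hxF (hb.Ah_disj_F k x hxA)
  · rcases hxT with hxh | ⟨j, hxU⟩ | hxu | ⟨_, hxA⟩ | ⟨k', hk, hxF'⟩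
    · exact hxh
    · exact absurd hxF (hb.U_disj_F j k x hxU)
    · rw [hxu] at hxF; exact absurd hxF (hb.u_notMem_F k)
    · exact absurd hxF (hb.Ah_disj_F k x hxA)
    · by_cases hkk : k = k'
      · subst hkk; rw [hk] at hk'; exact absurd hk' (by decide)
      · exact absurd hxF' (hb.F_disj k k' hkk x hxF)

/-- The coarse arm of `u` lies in the red cluster at such a point. -/
lemma MixedBase.coarseX_subset_cluster [Nonempty ι] (hup : ∃ e, ends e = s(u, p)) {q : Pt ι κ}
    (hs : ∀ j, q.1 j = true) (huP : q.2.2.1 = false) :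
    coarseX u U ⊆ cluster ends (mixedReal ends u p U Ah F σ q) h := by
  intro x hx
  rw [hb.cluster_top hup hs huP]
  rcases hx with hx | hx
  · exact Or.inr (Or.inr (Or.inl hx))
  · obtain ⟨j, hj⟩ := Set.mem_iUnion.1 hx
    exact Or.inr (Or.inl ⟨j, hj⟩)

/-- **The coarse arm of `u` is a union of arms of the hull** at such a point. -/
theorem MixedBase.armClosed_coarseX [Nonempty ι] (hup : ∃ e, ends e = s(u, p)) {q : Pt ι κ}
    (hs : ∀ j, q.1 j = true) (huP : q.2.2.1 = false) :
    ArmClosed ends (mixedReal ends u p U Ah F σ q) h (coarseX u U) where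
  subset := by
    intro x hx
    refine ⟨Or.inl (hb.coarseX_subset_cluster hup hs huP hx), ?_⟩
    rcases hx with hx | hx
    · rw [Set.mem_singleton_iff] at hx; rw [hx]; exact hb.hne_hu.symm
    · obtain ⟨j, hj⟩ := Set.mem_iUnion.1 hx
      rintro rfl; exact hb.h_notMem_U j hj
  closed := by
    intro e x y hxy hx hy hyh
    rcases hx with hx | hx
    · -- x = u: the edge goes into a u-arm or to p; p is not in the hull
      rw [Set.mem_singleton_iff] at hx
      rw [hx] at hxy
      rcases hb.u_edges e y hxy with ⟨j, hj⟩ | rfl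
      · exact Or.inr (Set.mem_iUnion.2 ⟨j, hj⟩)
      · exfalso
        rcases hy with hy | hy
        · rw [hb.cluster_top hup hs huP] at hy
          rcases hy with hyh' | ⟨j, hj⟩ | hyu | ⟨_, hA⟩ | ⟨k, _, hF⟩
          · exact hb.hne_hp hyh'.symm
          · exact hb.p_notMem_U j hj
          · exact hb.hne_up hyu.symm
          · exact hb.p_notMem_Ah hA
          · exact hb.p_notMem_F k hF
        · rw [hb.cluster_blue_top hup hs] at hy
          rcases hy with hyh' | ⟨_, hA⟩ | ⟨k, _, hF⟩
          · exact hb.hne_hp hyh'.symm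
          · exact hb.p_notMem_Ah hA
          · exact hb.p_notMem_F k hF
    · -- x in a u-arm: the edge stays inside, goes to h (excluded), to u, or outside the hull
      obtain ⟨j, hj⟩ := Set.mem_iUnion.1 hx
      obtain ⟨x', y', hxy', hx', hy'⟩ := hb.ends_of_touches_U ⟨x, hj, y, hxy⟩
      rw [hxy, Sym2.eq_iff] at hxy'
      rcases hxy' with ⟨h1, h2⟩ | ⟨h1, h2⟩
      · rw [← h2] at hy'
        rcases hy' with hy' | hy' | hy' | ⟨hyh', hyu, hyp, hout⟩
        · exact Or.inr (Set.mem_iUnion.2 ⟨j, hy'⟩)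
        · exact absurd hy' hyh
        · exact Or.inl hy'
        · exfalso
          rcases hy with hy | hy
          · rw [hb.cluster_top hup hs huP] at hy
            rcases hy with hyh'' | ⟨j', hj'⟩ | hyu' | ⟨_, hA⟩ | ⟨k, _, hF⟩
            · exact hyh hyh''
            · exact hout (Or.inl (Or.inl (Set.mem_iUnion.2 ⟨j', hj'⟩)))
            · exact hyu hyu'
            · exact hout (Or.inl (Or.inr hA))
            · exact hout (Or.inr (Set.mem_iUnion.2 ⟨k, hF⟩))
          · rw [hb.cluster_blue_top hup hs] at hy
            rcases hy with hyh'' | ⟨_, hA⟩ | ⟨k, _, hF⟩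
            · exact hyh hyh''
            · exact hout (Or.inl (Or.inr hA))
            · exact hout (Or.inr (Set.mem_iUnion.2 ⟨k, hF⟩))
      · rw [← h2] at hx'
        exact Or.inr (Set.mem_iUnion.2 ⟨j, hx'⟩)

/-- **G5 is the arm principle**: at a point with every u-arm red and `p` dropped, the X-move keeps
the conditioning. -/
theorem MixedBase.mem_tgtU_toggleX [Fintype E] [DecidableEq E] [Nonempty ι]
    (hup : ∃ e, ends e = s(u, p)) {Us : Set V}
    {l o : V} (hXU : coarseX u U ⊆ Us) (hl : l ∉ Us) {q : Pt ι κ} (hs : ∀ j, q.1 j = true)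
    (huP : q.2.2.1 = false)
    (hQ : mixedReal ends u p U Ah F σ q ∈ tgtU ends l h {S : Set V | o ∈ S}) :
    mixedReal ends u p U Ah F σ (toggleX q) ∈ tgtU ends l h {S : Set V | o ∈ S} := by
  rw [← hb.flip_coarseX]
  exact flip_mem_tgtU_of_armClosed_red (hb.coreFree_top hup hs huP)
    (hb.armClosed_coarseX hup hs huP) (hb.coarseX_subset_cluster hup hs huP) hXU hl hQ

end Arm

end BigBlock

end Summit.Ventures.PercRepro2
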